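import Summits.BirchSwinnertonDyer.Rank1Residual.X5.TwoAdicTargetsSplitEnd
import Summits.BirchSwinnertonDyer.Rank1Residual.X5.TwoAdicTargetsMultEndAlpha
import Literature.NumberTheory.EllipticCurves.Greenberg1999.EulerCharacteristicSplitMultiplicativeAnyPrime
import Literature.NumberTheory.EllipticCurves.PAdicHeightsProofs
import Literature.NumberTheory.EllipticCurves.PAdicBSDSplitMultiplicativeProofs
import HarnessLib

/-!
# Class O1 (X5, `p = 2`, non-CM): the END-STATE at a SPLIT MULTIPLICATIVE `2`, part 2 — S2 is
# PUBLISHED (`δ = 0`), (a) in Miller's currency given the `κ₁`-certificate, the deflated `μ = 0`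
# upgrade, and the per-pair consumers S6 / L3-13α (PROVED modulo the typed targets as hypotheses)

HONEST FRAMING (cell `b2b-bsdres`, run/shared/lean/b2b/bsd-rank1-residual/, verbatim in every
file): the goal of the cell is to DELETE the COMBINATION-SHAPED residual classes of the
Birch–Swinnerton-Dyer formula for ALL analytic-rank `≤ 1` elliptic curves over `ℚ` — "full BSD
formula for every rank `≤ 1` curve in class `C`" assembled STRICTLY from published theorems — so
that the rank-`≤ 1` remainder becomes exactly the CONSTRUCTION-SHAPED classes, which are TYPED
(missing-input `Prop`s), NOT attempted. This is not "finishing BSD". Research routes; no claim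
beyond stated classes; census output = EVIDENCE, never a Literature fact; nothing here is booked;
no mark of RESIDUAL-MAP §I moves.

Unit `b2b-bsdres-cc-typer-4` (lane CLASS-CLOSURE, class O1), gen 4; o1 lead PLAN v2.9 C79 (a) queue
item (2″), part 2 (continues `X5/TwoAdicTargetsSplitEnd.lean`; lens-3 GEN 6 G6.2 S5/S6 and G6.3
L3-13α). Theorems only; 0 typed targets, 0 named facts.

* **`twoAdicEulerCharRankZeroSplitMult_zero_of_greenberg` (PROVED)** — S2 with `δ = 0` IS the printed
  display: fed by the literature seat's named fact
  `Greenberg1999.thm41Analogue_charValue_rankZero_split_baseChange_anyPrime` (A236; Greenberg, LNM 1716,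
  §4 pp. 112–113 with §3 p. 94, base-change transcription, every `p`) through its `F = ℚ`, `p = 2`
  projection `….split_two` (this seat, p260918: `W.baseChange ℚ = W` definitionally, `e·f = 1`). For
  the census: the algebraic `δ` is NOT a slack source on split-`2` rank-`0` rows.
* **`upperBound_two_split_of_divisibilityRat` (PROVED)** — G11a-split (a) in Miller's currency with
  slack `k`, given the per-curve `κ₁`-CERTIFICATE `hκ : c₁ ≠ 0 ∧ ord₂ c₁ ≤ ord₂ [0]⁺_f + (ord₂ 𝓛₂(E) − 2)`
  (lens-3 S5, f-normalised — the period ratio `ϖ` cancels; `[0]⁺_f = ratPlusSymbol f 0 = L(E,1)/Ω⁺_f`;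
  it REPLACES the Greenberg–Stevens theorem, which has no located printed proof at `p = 2`; census
  P-SP2′: EQUALITY on 554/554 certified split rows, kit j128021 — EVIDENCE): `∃ q, #Ш_an = q ∧
  ord₂ #Ш ≤ ord₂ q + k`; `k = 0` at `ϖ′ = ϖ`.
* **`exists_mem_charIdeal_X_mul_of_mu_eq_zero` (PROVED, the deflated `μ = 0` upgrade)** — `L(0) = 0`,
  `ι(T·g) = 2ⁿ·L` with `g ∈ char_Λ X`, `μ(X) = 0`, and an integral normalisation `ι L₀ = ϖ·L` give
  `L₁ ∈ char_Λ X` with `ι(T·L₁) = ϖ·L`: deflate `L = T·L♭` (tree pattern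
  `Literature.Barriers.BirchSwinnertonDyer.eq_X_mul_shift_of_isSplitMultPAdicLFunctionOf`, Skinner 2016
  §2.4 "`𝓛_f = (γ − 1)·𝓛_f′`"), cancel `T` in the domains `ℚ₂⟦T⟧` / `ℤ₂⟦T⟧`, and apply the any-`L`
  upgrade `charIdeal_dvd_of_divisibility_of_mu_eq_zero` of `X5/TwoAdicTargetsMultEndAlpha.lean` to `L♭`.
* **`missingUpperBoundAt_two_split_of_mu_eq_zero` (PROVED, lens-3 S6)** — analytic rank `0`, split
  multiplicative `2`: S1 K11b-Rat for the newform (`hK`, NOT in print, AUDIT S–M) + `μ₂(X) = 0` for the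
  cyclotomic data (`hμ`: T10 tower-gap certificate on E[2]-irreducible rows; PRINT via Prop. 5.14 on the
  α-sp locus — `…_of_prop514`) + the Néron-integrality certificate `hint` (`∃ L₀, ι L₀ = ϖ·L`; refuter v7
  §30: automatic at a split `2` since `[1/2]⁺ = (a₂ − 1)[0]⁺ = 0` — to be proved Literature-side, kept as
  a binder here) + the `κ₁`-certificate `hκ` ⇒ `MissingUpperBoundAt W 2` (SHARP), modulo S2 (`hEC`; or
  PUBLISHED, `…_of_greenberg`), modularity and GZK by name. The Tate datum and `log₂ q_E ≠ 0` are
  DISCHARGED inside (`nonempty_tateParameterData_iff_holds`, `TateParameterData.padicLog_q_ne_zero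
  MahlerManinPadic_holds` — Silverman V.5.3, Barré-Sirieix–Diaz–Gramain–Philibert 1996). No image
  hypothesis, no slack, no exceptional-zero theorem.
* **`bsdp_two_split_of_mu_eq_zero_of_lowerBound`, `missingUpperBoundAt_two_split_of_prop514`,
  `bsdp_two_split_of_prop514_of_lowerBound_of_greenberg` (PROVED)** — the α-sp line (69 classes,
  L3-13α: `μ = 0 ∧ X` torsion IN PRINT from Prop. 5.14 at a multiplicative `2`, `….of_mult`). Per pair
  on α-sp ∧ r0 the inputs of `BSD(E,2)` are PRINT {5.14@2, A236@2, modularity, GZK, Mahler–Manin} +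
  K11b-Rat (AUDIT S–M) + the certificates `hint` (provable), `hκ`, `hlow`. Nothing is booked.
References: [GreenbergLNM1716] §4 pp. 112–113, §3 p. 94, Prop. 5.14 (p. 121);
[MazurTateTeitelbaum1986Invent] §I.10, §I.14–15, §II.1; [Skinner2016PacificMC] §2.4; [SilvermanATAEC1994]
Thm. V.5.3; [BarreSirieixDiazGramainPhilibert1996Manin] Thm. 1; [Miller2011LMS] Def. 1.1.
-/

set_option autoImplicit false

noncomputable section

open scoped Classical MatrixGroups ModularForm

open CongruenceSubgroup WeierstrassCurve Literature.NumberTheory.EllipticCurves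
  Literature.NumberTheory.EllipticCurves.ModularForms
  Literature.NumberTheory.EllipticCurves.Greenberg1999
  Literature.NumberTheory.EllipticCurves.Wuthrich2014
  Literature.NumberTheory.EllipticCurves.Rank1Residual
  Literature.NumberTheory.EllipticCurves.Rank1Residual.Typed
  Literature.NumberTheory.Transcendental

namespace Summit.BirchSwinnertonDyer.Rank1Residual.X5.O1

variable (W : WeierstrassCurve ℚ) [W.IsElliptic] [W.IsGloballyMinimal]

/-! ## §1 S2 at `δ = 0` is PUBLISHED (Greenberg's split display at `2`, named fact A236) -/

omit [W.IsGloballyMinimal] in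
/-- **`TwoAdicEulerCharRankZeroSplitMult W 0` from Greenberg's printed display (parity-free named
fact).** Given the vendored fact `Greenberg1999.thm41Analogue_charValue_rankZero_split_baseChange_anyPrime`
(Greenberg, LNM 1716, §4 pp. 112–113: "the analogue of theorem 4.1", `l_v = log_p(N q)/ord_p(N q) ·
[…]/(2p[…])` at a split multiplicative `v`), the O1 control target at a split multiplicative `2` holds
with `δ = 0`: `f_E(0) · #E(ℚ)(2)² = u · (𝓛₂(E)/4) · 2^{ord₂ ∏ c_ℓ} · #Sel_{2^∞}(E/ℚ)`, via the `F = ℚ`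
projection `….split_two`. The target's binders `Mult W 2`, `IsCyclotomicVariable 2 γ` are unused.
[cite: GreenbergLNM1716, §4 pp. 112–113 (held copy `book:coates1999-arithmetic-theory-elliptic-curves` p0112 L3–L5, p0113 L3–L11) and §3 p. 94] -/
theorem twoAdicEulerCharRankZeroSplitMult_zero_of_greenberg
    (h : thm41Analogue_charValue_rankZero_split_baseChange_anyPrime) :
    TwoAdicEulerCharRankZeroSplitMult W 0 := by
  intro _hmult _hsp κ γ hκ hγ _hγ' D _ hX fE hfE hfin Dq hlog
  obtain ⟨u, hu⟩ := h.split_two W Dq hlog κ γ hκ hγ D hX fE hfE hfin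
  refine ⟨u, ?_⟩
  rw [add_zero, zpow_natCast]
  exact hu

/-! ## §2 G11a-split (a) in Miller's currency, given the `κ₁`-certificate -/

/-- **G11a-split (a) in Miller's currency — the upper half with slack `k` at a split multiplicative
`2`**, given the per-curve `κ₁`-CERTIFICATE `hκ` (lens-3 S5: the valuation-level Greenberg–Stevens
inequality at `2`, f-normalised — the period ratio `ϖ` cancels —
`c₁ ≠ 0 ∧ ord₂ c₁ ≤ ord₂ [0]⁺_f + (ord₂ 𝓛₂(E) − 2)`, `[0]⁺_f = L(E,1)/Ω⁺_f = ratPlusSymbol f 0`;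
census P-SP2′: EQUALITY on 554/554 certified rows — EVIDENCE; this hypothesis REPLACES the
Greenberg–Stevens theorem, which has no located printed proof at `p = 2`): with the datum
`ι(T·g) = ϖ′ · L`, `g ∈ char_Λ X`, `X` torsion, `ord₂ ϖ′ ≤ ord₂ ϖ + k` (`ϖ · Ω_E = Ω⁺_f`), `L(E,1) ≠ 0`,
GZK (`#Ш_an = (L(E,1)/Ω_E) · #E(ℚ)² / ∏c_ℓ`) and S2 at `2` ⇒ `∃ q, #Ш_an = q ∧ ord₂ #Ш ≤ ord₂ q + k`;
at `k = 0` (e.g. `ϖ′ = ϖ`) this is `MissingUpperBoundAt W 2`.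
[cite: Miller2011LMS, Def. 1.1 and §1] [cite: GreenbergLNM1716, §4 pp. 112–113]
[cite: MazurTateTeitelbaum1986Invent, §I.14–15 and §II (the exceptional-zero conjecture; shape of hκ)] -/
theorem upperBound_two_split_of_divisibilityRat (hEC : TwoAdicEulerCharRankZeroSplitMult W 0)
    (hGZK : rank_eq_analyticRank_of_analyticRank_le_one)
    (hmult : Mult W 2) (hsp : W.HasSplitMultiplicativeReductionAtPrime 2)
    (hL : W.entireLFunction 1 ≠ 0)
    {κ : ZpExtension ℚ 2} {γ : Field.absoluteGaloisGroup ℚ} {N : ℕ} [NeZero N]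
    {f : CuspForm (Gamma0 N) 2} (hκ : κ.IsCyclotomic) (hγ : κ.IsTopGenerator γ)
    (hγ' : IsCyclotomicVariable 2 γ) (hf : IsNewformOf W f)
    (Dq : TateParameterData W 2) (hlog : padicLog 2 Dq.q ≠ 0) {L : PowerSeries ℚ_[2]}
    (hκ₁ : PowerSeries.coeff 1 L ≠ 0 ∧ (PowerSeries.coeff 1 L).valuation ≤
      padicValRat 2 (ratPlusSymbol f 0) + ((LInvariant Dq).valuation - 2))
    (D : W.SelmerDualData κ γ) (ϖ : ℚ)
    (hϖ : (ϖ : ℝ) * W.realPeriodRat = plusPeriod f) {ϖ' : ℚ} (hϖ'0 : ϖ' ≠ 0) (k : ℕ)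
    (hk : padicValRat 2 ϖ' ≤ padicValRat 2 ϖ + k)
    (hdiv : D.IsTorsion ∧ ∃ g ∈ D.charIdeal, iwasawaToPowerSeries 2 (PowerSeries.X * g) =
        PowerSeries.C (ϖ' : ℚ_[2]) * L) :
    ∃ q : ℚ, shaAn W = (q : ℂ) ∧ (padicValNat 2 W.shaOrder : ℤ) ≤ padicValRat 2 q + k := by
  have hr : W.analyticRank = 0 := analyticRank_eq_zero_of_entireLFunction_one_ne_zero W hL
  obtain ⟨-, hfin⟩ := hGZK W (by rw [hr]; exact zero_le_one)
  obtain ⟨hle, -⟩ := chainUpperAtTwoSplit_of_divisibilityRat W hEC hmult hsp hfin hκ hγ hγ' Dq hlog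
    hκ₁.1 D hϖ'0 hdiv
  -- the rational number `t = ϖ · [0]⁺_f = L(E,1)/Ω_E`, non-zero; `s = [0]⁺_f`
  have hΩpos : 0 < W.realPeriodRat := W.realPeriodRat_pos_holds
  have hϖ0 : ϖ ≠ 0 := by
    rintro rfl
    have hper : 0 < plusPeriod f := IsNewform0.plusPeriod_pos_holds hf.1 hf.coeffField_eq_bot
    rw [← hϖ, Rat.cast_zero, zero_mul] at hper
    exact lt_irrefl _ hper
  set s : ℚ := ratPlusSymbol f 0 with hs_def
  set t : ℚ := ϖ * s with ht_def
  have hLval : W.entireLFunction 1 = (((s : ℝ) * plusPeriod f : ℝ) : ℂ) := hf.entireLFunction_one_eq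
  have ht : W.entireLFunction 1 / (W.realPeriodRat : ℂ) = ((t : ℚ) : ℂ) := by
    rw [hLval, ← hϖ, div_eq_iff (Complex.ofReal_ne_zero.mpr hΩpos.ne'), ht_def]
    push_cast
    ring
  have hs0 : s ≠ 0 := by
    intro h0
    apply hL
    rw [hLval, h0]
    simp
  have hvt : padicValRat 2 t = padicValRat 2 ϖ + padicValRat 2 s := by
    rw [ht_def, padicValRat.mul hϖ0 hs0]
  -- combine (a) with the certificate: `ord₂ #Ш + ord₂ ∏c − 2 ord₂ #tors ≤ ord₂ t + k`
  have hmain : (padicValNat 2 W.shaOrder : ℤ) + padicValNat 2 W.tamagawaProduct -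
      2 * padicValNat 2 W.torsionOrder ≤ padicValRat 2 t + k := by
    have h2 := hκ₁.2
    rw [hvt]
    linarith
  -- Miller's currency: `#Ш_an = t · #E(ℚ)² / ∏ c_ℓ`
  obtain ⟨-, hE, -, hshaAn⟩ := shaAn_eq_of_L_one_div_eq hGZK W hL ht
  haveI := hE
  have hΩ : (W.realPeriodRat : ℂ) ≠ 0 := by exact_mod_cast W.realPeriodRat_pos_holds.ne'
  have ht0 : t ≠ 0 := by
    rintro h0
    apply hL
    rw [h0, Rat.cast_zero, div_eq_zero_iff] at ht
    exact ht.resolve_right hΩ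
  have hcard : (Nat.card W.toAffine.Point : ℚ) ≠ 0 := by
    exact_mod_cast (Nat.card_pos (α := W.toAffine.Point)).ne'
  have htam : (W.tamagawaProduct : ℚ) ≠ 0 := by
    exact_mod_cast (W.tamagawaProduct_pos_holds : 0 < W.tamagawaProduct).ne'
  have hcardT : (Nat.card W.toAffine.Point : ℚ) = (W.torsionOrder : ℚ) := by
    exact_mod_cast (W.torsionOrder_eq_natCard_of_finite).symm
  refine ⟨t * (Nat.card W.toAffine.Point : ℚ) ^ 2 / (W.tamagawaProduct : ℚ), hshaAn, ?_⟩
  rw [padicValRat.div (mul_ne_zero ht0 (pow_ne_zero 2 hcard)) htam,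
    padicValRat.mul ht0 (pow_ne_zero 2 hcard), padicValRat.pow, hcardT]
  simp only [padicValRat.of_nat, Nat.cast_ofNat]
  linarith


/-! ## §3 The deflated `μ = 0` upgrade at a split `2` (`L = T · L♭`) -/

omit [W.IsGloballyMinimal] in
/-- **The deflated `μ = 0` upgrade (PROVED; any `L ∈ ℚ₂⟦T⟧` with `L(0) = 0`).** If `X` is finitely
generated torsion with `μ(X) = 0`, `ι(T·g) = 2ⁿ · L` for some `g ∈ char_Λ X` (the `⊗ℚ` datum of
K11b-Rat), and `ι L₀ = ϖ · L` is an integral normalisation (`ϖ ∈ ℚ`), then there is `L₁ ∈ char_Λ X` with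
`ι(T·L₁) = ϖ · L`. Proof: deflate `L = T · L♭` (`L(0) = 0`; Mathlib `PowerSeries.eq_X_mul_shift_add_const`,
the pattern of `Literature.Barriers.BirchSwinnertonDyer.eq_X_mul_shift_of_isSplitMultPAdicLFunctionOf`),
cancel `T` (`ℚ₂⟦T⟧` a domain) to get `ι g = 2ⁿ · L♭`; `L₀(0) = 0` forces `L₀ = T · L₁` in `Λ`
(`PowerSeries.X_dvd_iff`) with `ι L₁ = ϖ · L♭`; the any-`L` upgrade
`charIdeal_dvd_of_divisibility_of_mu_eq_zero` applied to `L♭` gives `L₁ ∈ char_Λ X`.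
[cite: Skinner2016PacificMC, §2.4 (𝓛_f = (γ − 1)·𝓛_f′, the deflation)] [cite: GreenbergVatsal2000, p. 4 (μ = 0 upgrade, shape)] -/
theorem exists_mem_charIdeal_X_mul_of_mu_eq_zero {κ : ZpExtension ℚ 2}
    {γ : Field.absoluteGaloisGroup ℚ} (hγ : κ.IsTopGenerator γ) (D : W.SelmerDualData κ γ)
    (hX : D.IsTorsion) (hμ : D.mu = 0) {L : PowerSeries ℚ_[2]}
    (hL0 : PowerSeries.constantCoeff L = 0)
    (hdiv : ∃ (n : ℕ) (g : IwasawaAlgebra 2), g ∈ D.charIdeal ∧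
      iwasawaToPowerSeries 2 (PowerSeries.X * g) = PowerSeries.C ((2 : ℚ_[2]) ^ n) * L)
    {ϖ : ℚ} {L₀ : IwasawaAlgebra 2}
    (hL₀ : iwasawaToPowerSeries 2 L₀ = PowerSeries.C (ϖ : ℚ_[2]) * L) :
    ∃ L₁ : IwasawaAlgebra 2, L₁ ∈ D.charIdeal ∧
      iwasawaToPowerSeries 2 (PowerSeries.X * L₁) = PowerSeries.C (ϖ : ℚ_[2]) * L := by
  -- deflate: `L = T · L♭`
  set Lf : PowerSeries ℚ_[2] := PowerSeries.mk fun n => PowerSeries.coeff (n + 1) L with hLf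
  have hLX : L = PowerSeries.X * Lf := by
    conv_lhs => rw [PowerSeries.eq_X_mul_shift_add_const L]
    rw [hL0, map_zero, add_zero]
  -- the `⊗ℚ` datum deflated: `ι g = 2ⁿ · L♭`
  obtain ⟨n, g, hg, hι⟩ := hdiv
  have hι' : iwasawaToPowerSeries 2 g = PowerSeries.C ((2 : ℚ_[2]) ^ n) * Lf := by
    rw [map_mul, PowerSeries.map_X, hLX, mul_left_comm] at hι
    exact mul_left_cancel₀ PowerSeries.X_ne_zero hι
  -- `L₀(0) = 0`, so `L₀ = T · L₁` in `Λ`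
  have hL₀0 : PowerSeries.constantCoeff L₀ = 0 := by
    have h := congrArg PowerSeries.constantCoeff hL₀
    rw [constantCoeff_iwasawaToPowerSeries, map_mul, PowerSeries.constantCoeff_C, hL0, mul_zero] at h
    exact PadicInt.coe_eq_zero.mp h
  obtain ⟨L₁, hL₁⟩ := PowerSeries.X_dvd_iff.mpr hL₀0
  -- `ι L₁ = ϖ · L♭`
  have hιL₁ : iwasawaToPowerSeries 2 L₁ = PowerSeries.C (ϖ : ℚ_[2]) * Lf := by
    have h := hL₀
    rw [hL₁, map_mul, PowerSeries.map_X, hLX, mul_left_comm] at h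
    exact mul_left_cancel₀ PowerSeries.X_ne_zero h
  have hmem : L₁ ∈ D.charIdeal :=
    charIdeal_dvd_of_divisibility_of_mu_eq_zero W 2 hγ D hX hμ ⟨n, g, hg, hι'⟩ hιL₁
  refine ⟨L₁, hmem, ?_⟩
  rw [map_mul, PowerSeries.map_X, hιL₁, hLX]
  ring

/-! ## §4 The per-pair consumers at a split multiplicative `2` (lens-3 S6, L3-13α) -/

/-- **Lens-3 S6: `MissingUpperBoundAt W 2` at a SPLIT multiplicative `2` from `μ = 0`, K11b-Rat and the
two certificates (PROVED).** For `W` globally minimal with analytic rank `0` and split multiplicative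
reduction at `2` (`hmult`, `hsp`): the published inputs as hypotheses — Greenberg's split display at
`2` (`hEC`; PUBLISHED: `…_of_greenberg`), modularity (`hmod`), GZK (`hGZK`); the research input — S1
K11b-Rat for the newform at level `N_E` (`hK`, NOT in print, AUDIT S–M); and the certificate inputs —
`μ = 0` for the cyclotomic data (`hμ`), integrality of the NÉRON-normalised split `2`-adic
`L`-function `ϖ · L ∈ ι(Λ)` (`hint`), and the `κ₁`-certificate (`hκ₁`: `c₁ ≠ 0 ∧ ord₂ c₁ ≤ ord₂ [0]⁺_f +
(ord₂ 𝓛₂(E) − 2)` for the newform's split `2`-adic `L`-function and ANY Tate datum — all Tate data have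
the same `q`). The Tate datum and `log₂ q_E ≠ 0` are discharged inside (Silverman V.5.3; Mahler–Manin).
No image hypothesis, no slack, no exceptional-zero theorem. [cite: GreenbergLNM1716, §4 pp. 112–113]
[cite: MazurTateTeitelbaum1986Invent, §I.10, §I.14–15] [cite: Miller2011LMS, Def. 1.1]
[cite: SilvermanATAEC1994, Thm. V.5.3 (existence of the Tate parameter)] -/
theorem missingUpperBoundAt_two_split_of_mu_eq_zero (hEC : TwoAdicEulerCharRankZeroSplitMult W 0)
    (hmod : nonempty_modularParametrizationData)
    (hGZK : rank_eq_analyticRank_of_analyticRank_le_one)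
    (hK : ∀ [NeZero (W.conductorNorm ℤ)] (f : CuspForm (Gamma0 (W.conductorNorm ℤ)) 2)
      (L : PowerSeries ℚ_[2]), KatoDivisibilityAtTwoSplitMultRat W f L)
    (hμ : ∀ (κ : ZpExtension ℚ 2) (γ : Field.absoluteGaloisGroup ℚ), κ.IsCyclotomic →
      κ.IsTopGenerator γ → IsCyclotomicVariable 2 γ → ∀ D : W.SelmerDualData κ γ, D.mu = 0)
    (hint : ∀ [NeZero (W.conductorNorm ℤ)] (f : CuspForm (Gamma0 (W.conductorNorm ℤ)) 2),
      IsNewformOf W f → ∀ ϖ : ℚ, (ϖ : ℝ) * W.realPeriodRat = plusPeriod f →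
      ∀ L : PowerSeries ℚ_[2], IsSplitMultPAdicLFunctionOf f 2 L →
        ∃ L₀ : IwasawaAlgebra 2, iwasawaToPowerSeries 2 L₀ = PowerSeries.C (ϖ : ℚ_[2]) * L)
    (hκ₁ : ∀ [NeZero (W.conductorNorm ℤ)] (f : CuspForm (Gamma0 (W.conductorNorm ℤ)) 2),
      IsNewformOf W f → ∀ L : PowerSeries ℚ_[2], IsSplitMultPAdicLFunctionOf f 2 L →
      ∀ Dq : TateParameterData W 2, PowerSeries.coeff 1 L ≠ 0 ∧
        (PowerSeries.coeff 1 L).valuation ≤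
          padicValRat 2 (ratPlusSymbol f 0) + ((LInvariant Dq).valuation - 2))
    (hr : W.analyticRank = 0) (hmult : Mult W 2)
    (hsp : W.HasSplitMultiplicativeReductionAtPrime 2) : MissingUpperBoundAt W 2 := by
  haveI : NeZero (W.conductorNorm ℤ) := ⟨(W.conductorNorm_pos_holds).ne'⟩
  obtain ⟨Dm⟩ := hmod W
  have hf : IsNewformOf W Dm.f := Dm.isNewformOf
  have hL : W.entireLFunction 1 ≠ 0 :=
    (W.analyticRank_eq_zero_iff_holds hf.hasEntireLFunction).mp hr
  obtain ⟨ϖ, hϖpos, hϖeq, -⟩ := Dm.exists_rat_mul_realPeriodRat_eq_plusPeriod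
  obtain ⟨κ, hκ, γ, hγ, hγ'⟩ := exists_isCyclotomic_isTopGenerator_isCyclotomicVariable_holds 2
  obtain ⟨D⟩ := W.nonempty_selmerDualData_holds κ γ hγ
  obtain ⟨L, hLf⟩ := exists_isSplitMultPAdicLFunctionOf hsp hf
  obtain ⟨Dq⟩ := (nonempty_tateParameterData_iff_holds (W := W) (p := 2)).mpr hsp
  have hlog : padicLog 2 Dq.q ≠ 0 := Dq.padicLog_q_ne_zero MahlerManinPadic_holds
  obtain ⟨hX, n, g, hg, hι⟩ := hK Dm.f L κ γ hκ hγ hγ' hmult hsp hf hLf D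
  obtain ⟨L₀, hL₀⟩ := hint Dm.f hf ϖ hϖeq L hLf
  obtain ⟨L₁, hmem, hιL₁⟩ := exists_mem_charIdeal_X_mul_of_mu_eq_zero W hγ D hX (hμ κ γ hκ hγ hγ' D)
    hLf.constantCoeff_eq_zero ⟨n, g, hg, hι⟩ hL₀
  obtain ⟨q, hq, hle⟩ := upperBound_two_split_of_divisibilityRat W hEC hGZK hmult hsp hL hκ hγ hγ' hf
    Dq hlog (hκ₁ Dm.f hf L hLf Dq) D ϖ hϖeq hϖpos.ne' 0 (by simp) ⟨hX, L₁, hmem, hιL₁⟩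
  exact ⟨q, hq, by simpa using hle⟩

/-- **`BSD(E,2)` at a split multiplicative `2` from `μ = 0`, K11b-Rat, the two certificates and the
lower half (PROVED).** `missingUpperBoundAt_two_split_of_mu_eq_zero` + `MissingLowerBoundAt W 2` ⇒
`MissingPPartAt W 2` ⇒ `BSDp W 2` (GZK). [cite: Miller2011LMS, Def. 1.1 and §1] -/
theorem bsdp_two_split_of_mu_eq_zero_of_lowerBound (hEC : TwoAdicEulerCharRankZeroSplitMult W 0)
    (hmod : nonempty_modularParametrizationData)
    (hGZK : rank_eq_analyticRank_of_analyticRank_le_one)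
    (hK : ∀ [NeZero (W.conductorNorm ℤ)] (f : CuspForm (Gamma0 (W.conductorNorm ℤ)) 2)
      (L : PowerSeries ℚ_[2]), KatoDivisibilityAtTwoSplitMultRat W f L)
    (hμ : ∀ (κ : ZpExtension ℚ 2) (γ : Field.absoluteGaloisGroup ℚ), κ.IsCyclotomic →
      κ.IsTopGenerator γ → IsCyclotomicVariable 2 γ → ∀ D : W.SelmerDualData κ γ, D.mu = 0)
    (hint : ∀ [NeZero (W.conductorNorm ℤ)] (f : CuspForm (Gamma0 (W.conductorNorm ℤ)) 2),
      IsNewformOf W f → ∀ ϖ : ℚ, (ϖ : ℝ) * W.realPeriodRat = plusPeriod f →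
      ∀ L : PowerSeries ℚ_[2], IsSplitMultPAdicLFunctionOf f 2 L →
        ∃ L₀ : IwasawaAlgebra 2, iwasawaToPowerSeries 2 L₀ = PowerSeries.C (ϖ : ℚ_[2]) * L)
    (hκ₁ : ∀ [NeZero (W.conductorNorm ℤ)] (f : CuspForm (Gamma0 (W.conductorNorm ℤ)) 2),
      IsNewformOf W f → ∀ L : PowerSeries ℚ_[2], IsSplitMultPAdicLFunctionOf f 2 L →
      ∀ Dq : TateParameterData W 2, PowerSeries.coeff 1 L ≠ 0 ∧
        (PowerSeries.coeff 1 L).valuation ≤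
          padicValRat 2 (ratPlusSymbol f 0) + ((LInvariant Dq).valuation - 2))
    (hr : W.analyticRank = 0) (hmult : Mult W 2)
    (hsp : W.HasSplitMultiplicativeReductionAtPrime 2)
    (hlow : MissingLowerBoundAt W 2) : BSDp W 2 :=
  bsdp_of_missingPPartAt W 2 hGZK (by rw [hr]; exact zero_le_one)
    (missingPPartAt_of_lower_of_upper W 2 hlow
      (missingUpperBoundAt_two_split_of_mu_eq_zero W hEC hmod hGZK hK hμ hint hκ₁ hr hmult hsp))

/-- **L3-13α — `MissingUpperBoundAt W 2` on the Prop. 5.14 locus at a split `2` (PROVED).** `μ = 0`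
∧ `X` torsion IN PRINT (`h514`, the literature seat's `prop514_isTorsion_mu_eq_zero_two`, branch
`of_mult` — Prop. 5.14 is stated for "good, ordinary or multiplicative reduction at 2") on a curve
with a ramified-XOR-odd rational `2`-torsion point; with K11b-Rat (`hK`), `hint`, `hκ₁`, `hEC`,
modularity, GZK ⇒ `MissingUpperBoundAt W 2`. The α-sp line (69 split r0 residue classes with such a
member, lens-1 census, EVIDENCE). [cite: GreenbergLNM1716, Prop. 5.14 (p. 121) and §4 pp. 112–113]
[cite: Miller2011LMS, Def. 1.1] -/
theorem missingUpperBoundAt_two_split_of_prop514 (h514 : prop514_isTorsion_mu_eq_zero_two)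
    (hEC : TwoAdicEulerCharRankZeroSplitMult W 0) (hmod : nonempty_modularParametrizationData)
    (hGZK : rank_eq_analyticRank_of_analyticRank_le_one)
    (hK : ∀ [NeZero (W.conductorNorm ℤ)] (f : CuspForm (Gamma0 (W.conductorNorm ℤ)) 2)
      (L : PowerSeries ℚ_[2]), KatoDivisibilityAtTwoSplitMultRat W f L)
    (hint : ∀ [NeZero (W.conductorNorm ℤ)] (f : CuspForm (Gamma0 (W.conductorNorm ℤ)) 2),
      IsNewformOf W f → ∀ ϖ : ℚ, (ϖ : ℝ) * W.realPeriodRat = plusPeriod f →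
      ∀ L : PowerSeries ℚ_[2], IsSplitMultPAdicLFunctionOf f 2 L →
        ∃ L₀ : IwasawaAlgebra 2, iwasawaToPowerSeries 2 L₀ = PowerSeries.C (ϖ : ℚ_[2]) * L)
    (hκ₁ : ∀ [NeZero (W.conductorNorm ℤ)] (f : CuspForm (Gamma0 (W.conductorNorm ℤ)) 2),
      IsNewformOf W f → ∀ L : PowerSeries ℚ_[2], IsSplitMultPAdicLFunctionOf f 2 L →
      ∀ Dq : TateParameterData W 2, PowerSeries.coeff 1 L ≠ 0 ∧
        (PowerSeries.coeff 1 L).valuation ≤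
          padicValRat 2 (ratPlusSymbol f 0) + ((LInvariant Dq).valuation - 2))
    (hr : W.analyticRank = 0) (hmult : Mult W 2) (hsp : W.HasSplitMultiplicativeReductionAtPrime 2)
    {x y : ℚ} (hP : W.toAffine.Equation x y) (h2 : 2 * y + W.a₁ * x + W.a₃ = 0)
    (hΦ : (TwoTorsionRamifiedAtTwo x ∧ ¬ TwoTorsionOdd W x) ∨
      (TwoTorsionOdd W x ∧ ¬ TwoTorsionRamifiedAtTwo x)) : MissingUpperBoundAt W 2 :=
  missingUpperBoundAt_two_split_of_mu_eq_zero W hEC hmod hGZK hK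
    (fun _ _ hκ hγ _ D => (h514.of_mult W hmult hP h2 hΦ hκ hγ D).2) hint hκ₁ hr hmult hsp

/-- **α-sp END-STATE per pair: `BSD(E,2)` on the Prop. 5.14 locus at a split multiplicative `2` from
the lower half, with the control slot PUBLISHED (PROVED).** `missingUpperBoundAt_two_split_of_prop514`
with `hEC` fed by Greenberg's named fact A236, + `MissingLowerBoundAt W 2` ⇒ `BSDp W 2`. Per pair the
inputs are PRINT {Prop. 5.14 at `2`, the split display at `2`, modularity, GZK, Tate, Mahler–Manin} +
K11b-Rat (`hK`, NOT in print; price AUDIT S–M) + the certificates `hint`, `hκ₁`, `hlow`. One member per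
isogeny class suffices (`bsdp_two_iff_of_isIsogenous`). Nothing is booked.
[cite: GreenbergLNM1716, Prop. 5.14 (p. 121) and §4 pp. 112–113] [cite: Miller2011LMS, Def. 1.1 and §1] -/
theorem bsdp_two_split_of_prop514_of_lowerBound_of_greenberg
    (h514 : prop514_isTorsion_mu_eq_zero_two)
    (h41 : thm41Analogue_charValue_rankZero_split_baseChange_anyPrime)
    (hmod : nonempty_modularParametrizationData)
    (hGZK : rank_eq_analyticRank_of_analyticRank_le_one)
    (hK : ∀ [NeZero (W.conductorNorm ℤ)] (f : CuspForm (Gamma0 (W.conductorNorm ℤ)) 2)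
      (L : PowerSeries ℚ_[2]), KatoDivisibilityAtTwoSplitMultRat W f L)
    (hint : ∀ [NeZero (W.conductorNorm ℤ)] (f : CuspForm (Gamma0 (W.conductorNorm ℤ)) 2),
      IsNewformOf W f → ∀ ϖ : ℚ, (ϖ : ℝ) * W.realPeriodRat = plusPeriod f →
      ∀ L : PowerSeries ℚ_[2], IsSplitMultPAdicLFunctionOf f 2 L →
        ∃ L₀ : IwasawaAlgebra 2, iwasawaToPowerSeries 2 L₀ = PowerSeries.C (ϖ : ℚ_[2]) * L)
    (hκ₁ : ∀ [NeZero (W.conductorNorm ℤ)] (f : CuspForm (Gamma0 (W.conductorNorm ℤ)) 2),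
      IsNewformOf W f → ∀ L : PowerSeries ℚ_[2], IsSplitMultPAdicLFunctionOf f 2 L →
      ∀ Dq : TateParameterData W 2, PowerSeries.coeff 1 L ≠ 0 ∧
        (PowerSeries.coeff 1 L).valuation ≤
          padicValRat 2 (ratPlusSymbol f 0) + ((LInvariant Dq).valuation - 2))
    (hr : W.analyticRank = 0) (hmult : Mult W 2) (hsp : W.HasSplitMultiplicativeReductionAtPrime 2)
    {x y : ℚ} (hP : W.toAffine.Equation x y) (h2 : 2 * y + W.a₁ * x + W.a₃ = 0)
    (hΦ : (TwoTorsionRamifiedAtTwo x ∧ ¬ TwoTorsionOdd W x) ∨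
      (TwoTorsionOdd W x ∧ ¬ TwoTorsionRamifiedAtTwo x))
    (hlow : MissingLowerBoundAt W 2) : BSDp W 2 :=
  bsdp_of_missingPPartAt W 2 hGZK (by rw [hr]; exact zero_le_one)
    (missingPPartAt_of_lower_of_upper W 2 hlow
      (missingUpperBoundAt_two_split_of_prop514 W h514
        (twoAdicEulerCharRankZeroSplitMult_zero_of_greenberg W h41) hmod hGZK hK hint hκ₁ hr hmult hsp
        hP h2 hΦ))

/-- The general split consumer with the control slot PUBLISHED (`hEC` fed by A236).
[cite: GreenbergLNM1716, §4 pp. 112–113] [cite: Miller2011LMS, Def. 1.1] -/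
theorem missingUpperBoundAt_two_split_of_mu_eq_zero_of_greenberg
    (h41 : thm41Analogue_charValue_rankZero_split_baseChange_anyPrime)
    (hmod : nonempty_modularParametrizationData)
    (hGZK : rank_eq_analyticRank_of_analyticRank_le_one)
    (hK : ∀ [NeZero (W.conductorNorm ℤ)] (f : CuspForm (Gamma0 (W.conductorNorm ℤ)) 2)
      (L : PowerSeries ℚ_[2]), KatoDivisibilityAtTwoSplitMultRat W f L)
    (hμ : ∀ (κ : ZpExtension ℚ 2) (γ : Field.absoluteGaloisGroup ℚ), κ.IsCyclotomic →
      κ.IsTopGenerator γ → IsCyclotomicVariable 2 γ → ∀ D : W.SelmerDualData κ γ, D.mu = 0)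
    (hint : ∀ [NeZero (W.conductorNorm ℤ)] (f : CuspForm (Gamma0 (W.conductorNorm ℤ)) 2),
      IsNewformOf W f → ∀ ϖ : ℚ, (ϖ : ℝ) * W.realPeriodRat = plusPeriod f →
      ∀ L : PowerSeries ℚ_[2], IsSplitMultPAdicLFunctionOf f 2 L →
        ∃ L₀ : IwasawaAlgebra 2, iwasawaToPowerSeries 2 L₀ = PowerSeries.C (ϖ : ℚ_[2]) * L)
    (hκ₁ : ∀ [NeZero (W.conductorNorm ℤ)] (f : CuspForm (Gamma0 (W.conductorNorm ℤ)) 2),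
      IsNewformOf W f → ∀ L : PowerSeries ℚ_[2], IsSplitMultPAdicLFunctionOf f 2 L →
      ∀ Dq : TateParameterData W 2, PowerSeries.coeff 1 L ≠ 0 ∧
        (PowerSeries.coeff 1 L).valuation ≤
          padicValRat 2 (ratPlusSymbol f 0) + ((LInvariant Dq).valuation - 2))
    (hr : W.analyticRank = 0) (hmult : Mult W 2)
    (hsp : W.HasSplitMultiplicativeReductionAtPrime 2) : MissingUpperBoundAt W 2 :=
  missingUpperBoundAt_two_split_of_mu_eq_zero W
    (twoAdicEulerCharRankZeroSplitMult_zero_of_greenberg W h41) hmod hGZK hK hμ hint hκ₁ hr hmult hsp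

end Summit.BirchSwinnertonDyer.Rank1Residual.X5.O1

end
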